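import Literature.AnabelianGeometry.EtaleTheta.ThetaRootOrbits
import HarnessLib

/-!
# [EtTh] Cor 2.8 (i)/(iii): the transport / twist CALCULUS of the orbit data `ThetaOrbitData`, generic
# over the interface — the composition glue for the general-`γ` case

Mochizuki, *The Étale Theta Function …* [EtTh], Publ. RIMS 45 (2009), §2, Cor 2.8 (i), (iii), PRIMS PDF
p.42 (bib key `MochizukiEtTh2009`): "`γ` … induces an automorphism of [the subquotient] `Δ_Θ`"; "(i) … `γ`
preserves the property that `η̲̈^{Θ,l·ℤ×μ₂}` (resp. …) be of standard type — a property that determines this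
collection of classes up to multiplication by a root of unity of order `l` (resp. `1`; `l`; `1`)".

PROOF-ONLY companion (no `def`, no instance, no new `Prop`) of abc-iut-L2-t2's `ThetaRootOrbits.lean` (cell
abc-iut, blocks F/C, seat abc-iut-f-152; SUPPORT lemmas for FACT-LIST rows F-0640 `Cor28_i`, F-0641
`Cor28_iii`, F-0642 `EqUpToRootOfUnity`, F-0643 `InducesOnTheta` — not closing theorems; the rows' schema
witnesses are abc-iut-w4-d051's, the inner case is abc-iut-L2-t2's `Sec2Cor28i(ii)InnerOfEmbedding` /
`Sec2InnerInducesOnTheta`). GENERIC over `O : ThetaOrbitData T`: the algebra by which the conclusions of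
Cor 2.8 (i)/(iii) for `(γ₁, Γ_Θ,₁)` and `(γ₂, Γ_Θ,₂)` yield those for the composite, so that a general
`γ = (inner) ∘ (one outer datum, e.g. a lift of the inversion)` reduces to the two pieces:
`InducesOnTheta`: `inducesOnTheta_refl`, `.trans`, `.symm`, `.unique`, `.map_act` (`Γ_Θ ∘ act x =
act (Γ x) ∘ Γ_Θ`). `transport`: `transport_refl/_trans/_symm_transport/_twist`, `twist_twist`,
`twist_inv_twist`, `transport_trans_eq_self` (exact preservation composes: the shape of Cor 2.8 (iii)).
`IsStandardColl.transport`, `isStandardColl_transport_etaZMu2`: "of standard type" is PRESERVED by transport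
along ANY `(Γ, Γ_Θ)` with `InducesOnTheta` and `Γ`-stable finite `Dtau` — conjunct 1 of `Cor28_i` for every
such `γ`. `EqUpToRootOfUnity`: `.transport` (no commutativity); for a COMMUTATIVE cyclotome (true at the §1
model, companion `Sec2ThetaOrbitTransportCalculusOfEmbedding`) `.symm'`, `.trans'`, `.of_dvd` and the
COMPOSITION LAW `.comp_transport` (the shape of conjuncts 2–4 of `Cor28_i`).
HONEST FRAMING: [EtTh] is refereed; statements about the TYPED interface only; no side is taken on
[IUTchIII] Cor 3.12; typed ≠ proved.
-/

noncomputable section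

namespace Literature.AnabelianGeometry.EtaleTheta

open Literature.AnabelianGeometry.SemiGraphs ThetaCovers

universe u

namespace ThetaCovers.ThetaOrbitData

section generic

variable {l : ℕ} {T : TemperedCoverData.{u} l} (O : ThetaOrbitData T)

/-- `act x` on representatives: `act x [t] = [x t x⁻¹]`. [cite: MochizukiEtTh2009, Cor 2.8(i) p.42] -/
theorem act_mk (x : T.Gtp) (t : ↥O.top) :
    O.act x (QuotientGroup.mk t) =
      QuotientGroup.mk (⟨x * (t : T.Gtp) * x⁻¹, O.top_normal.conj_mem _ t.2 x⟩ : ↥O.top) := by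
  haveI := O.top_normal
  show (QuotientGroup.mk (MulAut.conjNormal x t) : O.DeltaTheta) = _
  congr 1

/-- The identity of `Π^tp_C` induces the identity of `Δ_Θ`. [cite: MochizukiEtTh2009, Cor 2.8(i) p.42] -/
theorem inducesOnTheta_refl :
    O.InducesOnTheta (ContinuousMulEquiv.refl T.Gtp) (MulEquiv.refl O.DeltaTheta) := by
  refine ⟨?_, fun d => rfl⟩
  ext g
  constructor
  · rintro ⟨t, ht, rfl⟩
    exact ht
  · intro hg
    exact ⟨g, hg, rfl⟩

variable {O}

/-- **`Γ_Θ` intertwines the conjugation actions**: if `Γ_Θ` is induced by `Γ`, then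
`Γ_Θ (act x a) = act (Γ x) (Γ_Θ a)`. [cite: MochizukiEtTh2009, Cor 2.8(i) p.42] -/
theorem InducesOnTheta.map_act {Γ : T.Gtp ≃ₜ* T.Gtp} {ΓΘ : O.DeltaTheta ≃* O.DeltaTheta}
    (h : O.InducesOnTheta Γ ΓΘ) (x : T.Gtp) (a : O.DeltaTheta) :
    ΓΘ (O.act x a) = O.act (Γ x) (ΓΘ a) := by
  obtain ⟨hΓ, hind⟩ := h
  induction a using QuotientGroup.induction_on with
  | H t =>
    rw [O.act_mk, hind, hind, O.act_mk]
    congr 1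
    apply Subtype.ext
    show Γ (x * (t : T.Gtp) * x⁻¹) = Γ x * Γ t * (Γ x)⁻¹
    rw [map_mul, map_mul, map_inv]

/-- **Uniqueness**: the automorphism of `Δ_Θ` induced by `Γ` is determined by `Γ` ("`γ` induces an
automorphism of `Δ_Θ`"). [cite: MochizukiEtTh2009, Cor 2.8(i) p.42] -/
theorem InducesOnTheta.unique {Γ : T.Gtp ≃ₜ* T.Gtp} {ΓΘ ΓΘ' : O.DeltaTheta ≃* O.DeltaTheta}
    (h : O.InducesOnTheta Γ ΓΘ) (h' : O.InducesOnTheta Γ ΓΘ') : ΓΘ = ΓΘ' := by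
  obtain ⟨hΓ, hind⟩ := h
  obtain ⟨hΓ', hind'⟩ := h'
  ext a
  induction a using QuotientGroup.induction_on with
  | H t => rw [hind, hind']

/-- **Composition**: if `Γ_Θ,₁` is induced by `Γ₁` and `Γ_Θ,₂` by `Γ₂`, then `Γ_Θ,₁ ≫ Γ_Θ,₂` is induced by
`Γ₁ ≫ Γ₂`. [cite: MochizukiEtTh2009, Cor 2.8(i) p.42] -/
theorem InducesOnTheta.trans {Γ₁ Γ₂ : T.Gtp ≃ₜ* T.Gtp} {ΓΘ₁ ΓΘ₂ : O.DeltaTheta ≃* O.DeltaTheta}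
    (h₁ : O.InducesOnTheta Γ₁ ΓΘ₁) (h₂ : O.InducesOnTheta Γ₂ ΓΘ₂) :
    O.InducesOnTheta (Γ₁.trans Γ₂) (ΓΘ₁.trans ΓΘ₂) := by
  obtain ⟨hΓ₁, hind₁⟩ := h₁
  obtain ⟨hΓ₂, hind₂⟩ := h₂
  have hΓ : O.top.map (Γ₁.trans Γ₂).toMulEquiv.toMonoidHom = O.top := by
    have hc : (Γ₁.trans Γ₂).toMulEquiv.toMonoidHom =
        Γ₂.toMulEquiv.toMonoidHom.comp Γ₁.toMulEquiv.toMonoidHom := rfl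
    rw [hc, ← Subgroup.map_map, hΓ₁, hΓ₂]
  refine ⟨hΓ, fun d => ?_⟩
  show ΓΘ₂ (ΓΘ₁ (QuotientGroup.mk d)) = _
  rw [hind₁, hind₂]
  rfl

/-- **Inversion**: if `Γ_Θ` is induced by `Γ`, then `Γ_Θ⁻¹` is induced by `Γ⁻¹`.
[cite: MochizukiEtTh2009, Cor 2.8(i) p.42] -/
theorem InducesOnTheta.symm {Γ : T.Gtp ≃ₜ* T.Gtp} {ΓΘ : O.DeltaTheta ≃* O.DeltaTheta}
    (h : O.InducesOnTheta Γ ΓΘ) : O.InducesOnTheta Γ.symm ΓΘ.symm := by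
  obtain ⟨hΓ, hind⟩ := h
  have hΓ' : O.top.map Γ.symm.toMulEquiv.toMonoidHom = O.top := by
    ext g
    constructor
    · rintro ⟨t, ht, rfl⟩
      obtain ⟨s, hs, rfl⟩ := hΓ.ge ht
      show Γ.symm (Γ s) ∈ O.top
      rwa [ContinuousMulEquiv.symm_apply_apply]
    · intro hg
      refine ⟨Γ g, hΓ.le ⟨g, hg, rfl⟩, ?_⟩
      show Γ.symm (Γ g) = g
      rw [ContinuousMulEquiv.symm_apply_apply]
  refine ⟨hΓ', fun d => ?_⟩
  rw [MulEquiv.symm_apply_eq, hind]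
  congr 1
  apply Subtype.ext
  show (d : T.Gtp) = Γ (Γ.symm d)
  rw [ContinuousMulEquiv.apply_symm_apply]

variable (O)

/-! ### `transport`: functoriality and interaction with `twist` -/

/-- Transport along the identity (with the identity of `Δ_Θ`) is the identity.
[cite: MochizukiEtTh2009, Cor 2.8(i) p.42] -/
theorem transport_refl (H : Subgroup T.Gtp)
    (hH : H.map (ContinuousMulEquiv.refl T.Gtp).toMulEquiv.toMonoidHom = H)
    (C : Set (Set (↥H → O.DeltaTheta))) :
    O.transport H (ContinuousMulEquiv.refl T.Gtp) hH (MulEquiv.refl O.DeltaTheta) C = C := by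
  unfold ThetaOrbitData.transport
  conv_rhs => rw [← Set.image_id C]
  refine Set.image_congr' fun c => ?_
  conv_rhs => rw [id, ← Set.image_id c]
  exact Set.image_congr' fun η => rfl

/-- **Functoriality**: transport along `Γ₁ ≫ Γ₂` (with `Γ_Θ,₁ ≫ Γ_Θ,₂`) is the transport along `Γ₁` of the
transport along `Γ₂` (a pull-back: contravariant). [cite: MochizukiEtTh2009, Cor 2.8(i) p.42] -/
theorem transport_trans (H : Subgroup T.Gtp) (Γ₁ Γ₂ : T.Gtp ≃ₜ* T.Gtp)
    (h₁ : H.map Γ₁.toMulEquiv.toMonoidHom = H) (h₂ : H.map Γ₂.toMulEquiv.toMonoidHom = H)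
    (h₁₂ : H.map (Γ₁.trans Γ₂).toMulEquiv.toMonoidHom = H)
    (ΓΘ₁ ΓΘ₂ : O.DeltaTheta ≃* O.DeltaTheta) (C : Set (Set (↥H → O.DeltaTheta))) :
    O.transport H (Γ₁.trans Γ₂) h₁₂ (ΓΘ₁.trans ΓΘ₂) C =
      O.transport H Γ₁ h₁ ΓΘ₁ (O.transport H Γ₂ h₂ ΓΘ₂ C) := by
  unfold ThetaOrbitData.transport
  rw [Set.image_image]
  refine Set.image_congr' fun c => ?_
  rw [Set.image_image]
  exact Set.image_congr' fun η => rfl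

/-- The stability witness for a composite. [cite: MochizukiEtTh2009, Cor 2.8(i) p.42] -/
theorem map_trans_eq (H : Subgroup T.Gtp) {Γ₁ Γ₂ : T.Gtp ≃ₜ* T.Gtp}
    (h₁ : H.map Γ₁.toMulEquiv.toMonoidHom = H) (h₂ : H.map Γ₂.toMulEquiv.toMonoidHom = H) :
    H.map (Γ₁.trans Γ₂).toMulEquiv.toMonoidHom = H := by
  have hc : (Γ₁.trans Γ₂).toMulEquiv.toMonoidHom =
      Γ₂.toMulEquiv.toMonoidHom.comp Γ₁.toMulEquiv.toMonoidHom := rfl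
  rw [hc, ← Subgroup.map_map, h₁, h₂]

/-- The stability witness for an inverse. [cite: MochizukiEtTh2009, Cor 2.8(i) p.42] -/
theorem map_symm_eq (H : Subgroup T.Gtp) {Γ : T.Gtp ≃ₜ* T.Gtp}
    (h : H.map Γ.toMulEquiv.toMonoidHom = H) : H.map Γ.symm.toMulEquiv.toMonoidHom = H := by
  ext g
  constructor
  · rintro ⟨t, ht, rfl⟩
    obtain ⟨s, hs, rfl⟩ := h.ge ht
    show Γ.symm (Γ s) ∈ H
    rwa [ContinuousMulEquiv.symm_apply_apply]
  · intro hg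
    refine ⟨Γ g, h.le ⟨g, hg, rfl⟩, ?_⟩
    show Γ.symm (Γ g) = g
    rw [ContinuousMulEquiv.symm_apply_apply]

/-- Transport along `Γ⁻¹` undoes transport along `Γ`. [cite: MochizukiEtTh2009, Cor 2.8(i) p.42] -/
theorem transport_symm_transport (H : Subgroup T.Gtp) (Γ : T.Gtp ≃ₜ* T.Gtp)
    (h : H.map Γ.toMulEquiv.toMonoidHom = H) (h' : H.map Γ.symm.toMulEquiv.toMonoidHom = H)
    (ΓΘ : O.DeltaTheta ≃* O.DeltaTheta) (C : Set (Set (↥H → O.DeltaTheta))) :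
    O.transport H Γ.symm h' ΓΘ.symm (O.transport H Γ h ΓΘ C) = C := by
  unfold ThetaOrbitData.transport
  rw [Set.image_image]
  conv_rhs => rw [← Set.image_id C]
  refine Set.image_congr' fun c => ?_
  rw [Set.image_image]
  conv_rhs => rw [id, ← Set.image_id c]
  refine Set.image_congr' fun η => ?_
  funext g
  show ΓΘ.symm.symm (ΓΘ.symm (η _)) = η g
  rw [MulEquiv.symm_symm, MulEquiv.apply_symm_apply]
  congr 1
  apply Subtype.ext
  show Γ (Γ.symm (g : T.Gtp)) = g
  rw [ContinuousMulEquiv.apply_symm_apply]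

/-- Twists compose: `(C·κ₁)·κ₂ = C·(κ₁κ₂)`. [cite: MochizukiEtTh2009, Cor 2.8(i) p.42] -/
theorem twist_twist (H : Subgroup T.Gtp) (κ₁ κ₂ : T.Gtp → O.DeltaTheta)
    (C : Set (Set (↥H → O.DeltaTheta))) :
    O.twist H κ₂ (O.twist H κ₁ C) = O.twist H (κ₁ * κ₂) C := by
  unfold ThetaOrbitData.twist
  rw [Set.image_image]
  refine Set.image_congr' fun c => ?_
  rw [Set.image_image]
  refine Set.image_congr' fun η => ?_
  funext g
  exact mul_assoc _ _ _

/-- **Transport of a twist**: `Γ·(C·κ) = (Γ·C)·κ'` with `κ' = Γ_Θ⁻¹ ∘ κ ∘ Γ`.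
[cite: MochizukiEtTh2009, Cor 2.8(i) p.42] -/
theorem transport_twist (H : Subgroup T.Gtp) (Γ : T.Gtp ≃ₜ* T.Gtp)
    (hH : H.map Γ.toMulEquiv.toMonoidHom = H) (ΓΘ : O.DeltaTheta ≃* O.DeltaTheta)
    (κ : T.Gtp → O.DeltaTheta) (C : Set (Set (↥H → O.DeltaTheta))) :
    O.transport H Γ hH ΓΘ (O.twist H κ C) =
      O.twist H (fun x => ΓΘ.symm (κ (Γ x))) (O.transport H Γ hH ΓΘ C) := by
  unfold ThetaOrbitData.transport ThetaOrbitData.twist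
  rw [Set.image_image, Set.image_image]
  refine Set.image_congr' fun c => ?_
  rw [Set.image_image, Set.image_image]
  refine Set.image_congr' fun η => ?_
  funext g
  exact map_mul ΓΘ.symm _ _

/-- Twisting by `κ⁻¹` undoes twisting by `κ`. [cite: MochizukiEtTh2009, Cor 2.8(i) p.42] -/
theorem twist_inv_twist (H : Subgroup T.Gtp) (κ : T.Gtp → O.DeltaTheta)
    (C : Set (Set (↥H → O.DeltaTheta))) : O.twist H κ⁻¹ (O.twist H κ C) = C := by
  rw [O.twist_twist]
  unfold ThetaOrbitData.twist
  conv_rhs => rw [← Set.image_id C]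
  refine Set.image_congr' fun c => ?_
  conv_rhs => rw [id, ← Set.image_id c]
  refine Set.image_congr' fun η => ?_
  funext g
  show η g * (κ g * (κ g)⁻¹) = η g
  rw [mul_inv_cancel, mul_one]

/-- Exact preservation composes: if `(Γ₁, Γ_Θ,₁)` and `(Γ₂, Γ_Θ,₂)` both map `C` onto itself, so does the
composite (the shape of the conclusions of Cor 2.8 (iii)). [cite: MochizukiEtTh2009, Cor 2.8(iii) p.42] -/
theorem transport_trans_eq_self (H : Subgroup T.Gtp) {Γ₁ Γ₂ : T.Gtp ≃ₜ* T.Gtp}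
    (h₁ : H.map Γ₁.toMulEquiv.toMonoidHom = H) (h₂ : H.map Γ₂.toMulEquiv.toMonoidHom = H)
    (h₁₂ : H.map (Γ₁.trans Γ₂).toMulEquiv.toMonoidHom = H)
    {ΓΘ₁ ΓΘ₂ : O.DeltaTheta ≃* O.DeltaTheta} {C : Set (Set (↥H → O.DeltaTheta))}
    (e₁ : O.transport H Γ₁ h₁ ΓΘ₁ C = C) (e₂ : O.transport H Γ₂ h₂ ΓΘ₂ C = C) :
    O.transport H (Γ₁.trans Γ₂) h₁₂ (ΓΘ₁.trans ΓΘ₂) C = C := by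
  rw [O.transport_trans H Γ₁ Γ₂ h₁ h₂ h₁₂, e₂, e₁]

/-! ### `Dtau`-stability under `Γ⁻¹`; "of standard type" is preserved by transport -/

/-- If the (finite) set `Dtau` of decomposition groups over `τ^{±1}` is `Γ`-stable ("`γ` maps [the
decomposition groups over] `τ` to [those over] `τ^{±1}`"), it is `Γ⁻¹`-stable.
[cite: MochizukiEtTh2009, Def 1.9 p.29] -/
theorem map_symm_mem_Dtau_of_finite (hfin : O.Dtau.Finite) {Γ : T.Gtp ≃ₜ* T.Gtp}
    (hD : ∀ D ∈ O.Dtau, D.map Γ.toMulEquiv.toMonoidHom ∈ O.Dtau) :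
    ∀ D ∈ O.Dtau, D.map Γ.symm.toMulEquiv.toMonoidHom ∈ O.Dtau := by
  haveI : Finite ↥O.Dtau := hfin.to_subtype
  let φ : ↥O.Dtau → ↥O.Dtau := fun D => ⟨D.1.map Γ.toMulEquiv.toMonoidHom, hD D.1 D.2⟩
  have hφ : Function.Injective φ := fun D D' h =>
    Subtype.ext (Subgroup.map_injective Γ.injective (congrArg Subtype.val h))
  intro D hDm
  obtain ⟨D', hD'⟩ := Finite.surjective_of_injective hφ ⟨D, hDm⟩
  have hDD' : D'.1.map Γ.toMulEquiv.toMonoidHom = D := congrArg Subtype.val hD'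
  have hc : Γ.symm.toMulEquiv.toMonoidHom.comp Γ.toMulEquiv.toMonoidHom = MonoidHom.id _ :=
    MonoidHom.ext fun g => Γ.symm_apply_apply g
  rw [← hDD', Subgroup.map_map, hc, Subgroup.map_id]
  exact D'.2

variable {O}

/-- **"`γ` preserves the property … of standard type"** — GENERIC: if `Γ_Θ` is induced by `Γ` and `Dtau` is
`Γ⁻¹`-stable, the transport along `(Γ, Γ_Θ)` of a collection of standard type is of standard type (read at
`Γ⁻¹D`: `(Γ_Θ⁻¹ η(Γ·))² = Γ_Θ⁻¹(∂d) = ∂(Γ_Θ⁻¹ d)` by `InducesOnTheta.map_act`). Conjunct 1 of `Cor28_i`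
for EVERY such pair, not only the inner ones. [cite: MochizukiEtTh2009, Cor 2.8(i) p.42] -/
theorem IsStandardColl.transport {Γ : T.Gtp ≃ₜ* T.Gtp} {ΓΘ : O.DeltaTheta ≃* O.DeltaTheta}
    (hind : O.InducesOnTheta Γ ΓΘ)
    (hD : ∀ D ∈ O.Dtau, D.map Γ.symm.toMulEquiv.toMonoidHom ∈ O.Dtau)
    (hY : T.PiYddtp.map Γ.toMulEquiv.toMonoidHom = T.PiYddtp)
    {C : Set (Set (↥T.PiYddtp → O.DeltaTheta))} (hC : O.IsStandardColl C) :
    O.IsStandardColl (O.transport _ Γ hY ΓΘ C) := by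
  obtain ⟨D, hDm, c, hc, η, hη, d, hstd⟩ := hC
  refine ⟨D.map Γ.symm.toMulEquiv.toMonoidHom, hD D hDm, _, Set.mem_image_of_mem _ hc, _,
    Set.mem_image_of_mem _ hη, ΓΘ.symm d, ?_⟩
  rintro _ ⟨t, ht, rfl⟩
  have hΓt : Γ (Γ.symm.toMulEquiv.toMonoidHom t) = t := Γ.apply_symm_apply t
  have key : ∀ p : Γ (Γ.symm.toMulEquiv.toMonoidHom t) ∈ T.PiYddtp,
      η ⟨Γ (Γ.symm.toMulEquiv.toMonoidHom t), p⟩ = η ⟨t, (O.Dtau_le D hDm ht).1⟩ := fun p => by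
    congr 1
    exact Subtype.ext hΓt
  show ΓΘ.symm (η ⟨Γ (Γ.symm.toMulEquiv.toMonoidHom t), _⟩) ^ 2 = _
  rw [key, ← map_pow, hstd t ht, map_mul, map_inv, hind.symm.map_act]
  show O.act (Γ.symm t) (ΓΘ.symm d) * (ΓΘ.symm d)⁻¹ = _
  rfl

variable (O)

/-- **Cor 2.8 (i), conjunct 1 — GENERIC for every `(Γ, Γ_Θ)` with `InducesOnTheta`** (finite `Dtau`): if
`η̈^{Θ,ℤ×μ₂}` is of standard type, `Γ_Θ` is induced by `Γ`, and `Γ` permutes `Dtau`, then the transport of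
`η̈^{Θ,ℤ×μ₂}` along `(Γ, Γ_Θ)` is of standard type. [cite: MochizukiEtTh2009, Cor 2.8(i) p.42] -/
theorem isStandardColl_transport_etaZMu2 (hfin : O.Dtau.Finite) (hstd : O.IsStandard)
    {Γ : T.Gtp ≃ₜ* T.Gtp} {ΓΘ : O.DeltaTheta ≃* O.DeltaTheta} (hind : O.InducesOnTheta Γ ΓΘ)
    (hD : ∀ D ∈ O.Dtau, D.map Γ.toMulEquiv.toMonoidHom ∈ O.Dtau)
    (hY : T.PiYddtp.map Γ.toMulEquiv.toMonoidHom = T.PiYddtp) :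
    O.IsStandardColl (O.transport _ Γ hY ΓΘ O.etaZMu2) :=
  IsStandardColl.transport hind (O.map_symm_mem_Dtau_of_finite hfin hD) hY hstd

/-! ### `EqUpToRootOfUnity`: transport-stability, equivalence relation, composition law -/

variable {O}

/-- **Transport-stability** (no commutativity needed): if `C' = C·κ` up to a root of unity of order `n` and
`Γ_Θ` is induced by `Γ` (which respects the `G_K`-fibres), then `Γ·C' = (Γ·C)·κ'` with
`κ' = Γ_Θ⁻¹ ∘ κ ∘ Γ` again an inflated cocycle whose class is killed by `n`.
[cite: MochizukiEtTh2009, Cor 2.8(i) p.42] -/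
theorem EqUpToRootOfUnity.transport {n : ℕ} {H : Subgroup T.Gtp} {C C' : Set (Set (↥H → O.DeltaTheta))}
    {Γ : T.Gtp ≃ₜ* T.Gtp} {ΓΘ : O.DeltaTheta ≃* O.DeltaTheta} (hind : O.InducesOnTheta Γ ΓΘ)
    (hK : ∀ x y : T.Gtp, T.aug (T.toHat x) = T.aug (T.toHat y) →
      T.aug (T.toHat (Γ x)) = T.aug (T.toHat (Γ y)))
    (hH : H.map Γ.toMulEquiv.toMonoidHom = H) (h : O.EqUpToRootOfUnity n H C C') :
    O.EqUpToRootOfUnity n H (O.transport H Γ hH ΓΘ C) (O.transport H Γ hH ΓΘ C') := by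
  obtain ⟨κ, hinf, hcoc, ⟨d, hd⟩, rfl⟩ := h
  refine ⟨fun x => ΓΘ.symm (κ (Γ x)), fun x y hxy => ?_, fun x y => ?_, ⟨ΓΘ.symm d, fun x => ?_⟩,
    O.transport_twist H Γ hH ΓΘ κ C⟩
  · exact congrArg ΓΘ.symm (hinf _ _ (hK x y hxy))
  · show ΓΘ.symm (κ (Γ (x * y))) = ΓΘ.symm (κ (Γ x)) * O.act x (ΓΘ.symm (κ (Γ y)))
    rw [map_mul Γ, hcoc, map_mul, hind.symm.map_act, ContinuousMulEquiv.symm_apply_apply]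
  · show ΓΘ.symm (κ (Γ x)) ^ n = O.act x (ΓΘ.symm d) * (ΓΘ.symm d)⁻¹
    rw [← map_pow, hd, map_mul, map_inv, hind.symm.map_act, ContinuousMulEquiv.symm_apply_apply]

/-- **Symmetry** (commutative `Δ_Θ`): witness `κ⁻¹`, `(κ⁻¹)^n = ∂(d⁻¹)`. [cite: MochizukiEtTh2009, Cor 2.8(i) p.42] -/
theorem EqUpToRootOfUnity.symm' (hcomm : ∀ a b : O.DeltaTheta, a * b = b * a) {n : ℕ}
    {H : Subgroup T.Gtp} {C C' : Set (Set (↥H → O.DeltaTheta))} (h : O.EqUpToRootOfUnity n H C C') :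
    O.EqUpToRootOfUnity n H C' C := by
  obtain ⟨κ, hinf, hcoc, ⟨d, hd⟩, rfl⟩ := h
  refine ⟨κ⁻¹, fun x y hxy => ?_, fun x y => ?_, ⟨d⁻¹, fun x => ?_⟩, (O.twist_inv_twist H κ C).symm⟩
  · simp only [Pi.inv_apply, hinf x y hxy]
  · simp only [Pi.inv_apply]
    rw [hcoc, mul_inv_rev, map_inv, hcomm]
  · simp only [Pi.inv_apply, inv_pow, hd, mul_inv_rev, inv_inv, map_inv]
    exact hcomm _ _

/-- **Transitivity** (commutative `Δ_Θ`): witness `κ₁κ₂`, `(κ₁κ₂)^n = ∂(d₁d₂)`.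
[cite: MochizukiEtTh2009, Cor 2.8(i) p.42] -/
theorem EqUpToRootOfUnity.trans' (hcomm : ∀ a b : O.DeltaTheta, a * b = b * a) {n : ℕ}
    {H : Subgroup T.Gtp} {C C' C'' : Set (Set (↥H → O.DeltaTheta))}
    (h₁ : O.EqUpToRootOfUnity n H C C') (h₂ : O.EqUpToRootOfUnity n H C' C'') :
    O.EqUpToRootOfUnity n H C C'' := by
  letI : CommGroup O.DeltaTheta := { (inferInstance : Group O.DeltaTheta) with mul_comm := hcomm }
  obtain ⟨κ₁, hinf₁, hcoc₁, ⟨d₁, hd₁⟩, rfl⟩ := h₁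
  obtain ⟨κ₂, hinf₂, hcoc₂, ⟨d₂, hd₂⟩, rfl⟩ := h₂
  refine ⟨κ₁ * κ₂, fun x y hxy => ?_, fun x y => ?_, ⟨d₁ * d₂, fun x => ?_⟩,
    O.twist_twist H κ₁ κ₂ C⟩
  · simp only [Pi.mul_apply, hinf₁ x y hxy, hinf₂ x y hxy]
  · simp only [Pi.mul_apply, hcoc₁, hcoc₂, map_mul]
    simp only [mul_assoc, mul_left_comm (κ₂ x)]
  · simp only [Pi.mul_apply, mul_pow, hd₁, hd₂, map_mul, mul_inv]
    simp only [mul_assoc, mul_left_comm d₁⁻¹]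

/-- **Monotonicity in the order** (commutative `Δ_Θ`): a root of unity of order dividing `n` has order
dividing any multiple `m` of `n` (`κ^{nk} = ∂(d^k)`). [cite: MochizukiEtTh2009, Cor 2.8(i) p.42] -/
theorem EqUpToRootOfUnity.of_dvd (hcomm : ∀ a b : O.DeltaTheta, a * b = b * a) {n m : ℕ} (hnm : n ∣ m)
    {H : Subgroup T.Gtp} {C C' : Set (Set (↥H → O.DeltaTheta))} (h : O.EqUpToRootOfUnity n H C C') :
    O.EqUpToRootOfUnity m H C C' := by
  letI : CommGroup O.DeltaTheta := { (inferInstance : Group O.DeltaTheta) with mul_comm := hcomm }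
  obtain ⟨k, rfl⟩ := hnm
  obtain ⟨κ, hinf, hcoc, ⟨d, hd⟩, rfl⟩ := h
  refine ⟨κ, hinf, hcoc, ⟨d ^ k, fun x => ?_⟩, rfl⟩
  rw [pow_mul, hd, mul_pow, map_pow, inv_pow]

variable (O)

/-- **COMPOSITION LAW** (commutative `Δ_Θ`): if `C` agrees with its transport along `(Γ₁, Γ_Θ,₁)` up to a
root of unity of order `n`, and with its transport along `(Γ₂, Γ_Θ,₂)` likewise, and `Γ_Θ,₁` is induced by
`Γ₁` (respecting the `G_K`-fibres), then `C` agrees with its transport along the composite `(Γ₁ ≫ Γ₂,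
Γ_Θ,₁ ≫ Γ_Θ,₂)` up to a root of unity of order `n` — the shape of conjuncts 2–4 of `Cor28_i`, so that the
general `γ` = (inner) ∘ (one outer datum) reduces to the two pieces. [cite: MochizukiEtTh2009, Cor 2.8(i) p.42] -/
theorem EqUpToRootOfUnity.comp_transport (hcomm : ∀ a b : O.DeltaTheta, a * b = b * a) {n : ℕ}
    {H : Subgroup T.Gtp} {C : Set (Set (↥H → O.DeltaTheta))}
    {Γ₁ Γ₂ : T.Gtp ≃ₜ* T.Gtp} {ΓΘ₁ ΓΘ₂ : O.DeltaTheta ≃* O.DeltaTheta} (hind₁ : O.InducesOnTheta Γ₁ ΓΘ₁)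
    (hK₁ : ∀ x y : T.Gtp, T.aug (T.toHat x) = T.aug (T.toHat y) →
      T.aug (T.toHat (Γ₁ x)) = T.aug (T.toHat (Γ₁ y)))
    (h₁ : H.map Γ₁.toMulEquiv.toMonoidHom = H) (h₂ : H.map Γ₂.toMulEquiv.toMonoidHom = H)
    (h₁₂ : H.map (Γ₁.trans Γ₂).toMulEquiv.toMonoidHom = H)
    (e₁ : O.EqUpToRootOfUnity n H C (O.transport H Γ₁ h₁ ΓΘ₁ C))
    (e₂ : O.EqUpToRootOfUnity n H C (O.transport H Γ₂ h₂ ΓΘ₂ C)) :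
    O.EqUpToRootOfUnity n H C (O.transport H (Γ₁.trans Γ₂) h₁₂ (ΓΘ₁.trans ΓΘ₂) C) := by
  rw [O.transport_trans H Γ₁ Γ₂ h₁ h₂ h₁₂]
  exact EqUpToRootOfUnity.trans' hcomm e₁ (e₂.transport hind₁ hK₁ h₁)

end generic

end ThetaCovers.ThetaOrbitData

end Literature.AnabelianGeometry.EtaleTheta

end
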